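import Mathlib
import Summits.Ventures.PercRepro2.Defs
import Summits.Ventures.PercRepro2.Graph
import Summits.Ventures.PercRepro2.HullDefs
import Summits.Ventures.PercRepro2.Switching
import Summits.Ventures.PercRepro2.LastVertex
import Summits.Ventures.PercRepro2.ReimerIncreasing
import Summits.Ventures.PercRepro2.ReimerDecreasing
import Summits.Ventures.PercRepro2.TwoClusterBK
import Summits.Ventures.PercRepro2.OneSidedBase
import Summits.Ventures.PercRepro2.RigidOneSided
import Summits.Ventures.PercRepro2.TypedRigidOneSided

/-!
# The typed rigid one-sided permutation on a PINNED fibre (blind cell PercRepro2, night-4 g7,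
2026-08-25; proofs/NIGHT4-G7.md §7.1, §8f)

The side statements of the 2-cut composition of the rigid row live on fibres with PINNED edges: a
set `P` of edges held red and a set `PB` held blue (the virtual edge `uv` of a 2-cut in its state).
This file proves the typed rigid one-sided permutation (RO) on such a fibre for a SAME-PIN transition:
on `tClassP = {ζ : ζ = red on P, blue on PB, C_R(u) ∈ 𝓤, h ∉ C_R(u)}` there is a permutation under
which every FREE red edge inside the red cluster of `h` is blue in the image
(`exists_typedRigidOneSidedPinned`).  The proof is g6's proof of `TypedRO.exists_typedRigidOneSided`
run on the cube of the free edges `U = univ ∖ (P ∪ PB)`: the cell's Reimer lemma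
`ReimerCube.reimer_decreasing` takes the ground set as a parameter, the events are read through the
full configuration `S ∪ P`, and the witnesses are the `u`- and `h`-components of `S ∪ P` minus the
pins.  Census (night-4 g7, pinned.py / pinned2.py): 0 failures for every pin transition of the typed
(RO) on all connected graphs `n ≤ 6` (`n = 6`: 0 / 56,696 resp. 0 / 41,828 per transition).
-/

namespace Summit.Ventures.PercRepro2

namespace TypedROP

open Hull ReimerCube OneSided RigidOS TypedRO

open scoped Classical

variable {V : Type*} {E : Type*} [Fintype E] [DecidableEq E] (ends : E → Sym2 V)

/-- A configuration respects the pins: red on `P`, blue on `PB`. -/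
def Pinned (P PB : Finset E) (ζ : Config E) : Prop := (∀ e ∈ P, ζ e = true) ∧ (∀ e ∈ PB, ζ e = false)

/-- The pinned typed class `{ζ pinned : C_R(u) ∈ 𝓤, h ∉ C_R(u)}`. -/
noncomputable def tClassP (P PB : Finset E) (u h : V) (𝓤 : Set (Set V)) : Finset (Config E) :=
  Finset.univ.filter fun ζ => Pinned P PB ζ ∧ cluster ends ζ u ∈ 𝓤 ∧ h ∉ cluster ends ζ u

/-- The FREE red edges inside the red cluster of `h`. -/
noncomputable def hRedFree (P PB : Finset E) (h : V) (ζ : Config E) : Finset E :=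
  hRed ends h ζ \ (P ∪ PB)

/-- The free edges. -/
def freeE (P PB : Finset E) : Finset E := Finset.univ \ (P ∪ PB)

/-- A free red edge inside the red cluster of `h` lies in `hRedFree`. -/
lemma mem_hRedFree_of {P PB : Finset E} {h : V} {ζ : Config E} {e : E}
    (he : e ∈ within ends (cluster ends ζ h)) (hred : ζ e = true) (hfree : e ∉ P ∪ PB) :
    e ∈ hRedFree ends P PB h ζ :=
  Finset.mem_sdiff.2 ⟨mem_hRed_of ends he hred, hfree⟩

/-! ## The bridge between pinned configurations and subsets of the free edges -/

/-- From a subset of the free edges to the pinned configuration with that free red set. -/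
def cfg (P : Finset E) (S : Finset E) : Config E := ofFinset (S ∪ P)

/-- The free red set of a configuration. -/
def freeRed (P PB : Finset E) (ζ : Config E) : Finset E := toFinset ζ \ (P ∪ PB)

/-- A free red set gives a pinned configuration. -/
lemma pinned_cfg {P PB : Finset E} (hd : Disjoint P PB) {S : Finset E} (hS : S ⊆ freeE P PB) :
    Pinned P PB (cfg P S) := by
  refine ⟨fun e he => ?_, fun e he => ?_⟩
  · simp [cfg, ofFinset_apply, he]
  · have h1 : e ∉ P := Finset.disjoint_right.1 hd he
    have h2 : e ∉ S := fun hs => by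
      have := hS hs
      simp [freeE, Finset.mem_sdiff, he] at this
    simp [cfg, ofFinset_apply, h1, h2]

/-- `cfg ∘ freeRed = id` on pinned configurations. -/
lemma cfg_freeRed {P PB : Finset E} {ζ : Config E} (hζ : Pinned P PB ζ) :
    cfg P (freeRed P PB ζ) = ζ := by
  funext e
  simp only [cfg, freeRed, ofFinset_apply, Finset.mem_union, Finset.mem_sdiff, toFinset,
    Finset.mem_filter, Finset.mem_univ, true_and]
  by_cases hP : e ∈ P
  · simp [hP, hζ.1 e hP]
  · by_cases hB : e ∈ PB
    · simp [hP, hB, hζ.2 e hB]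
    · simp [hP, hB]

/-- `freeRed ∘ cfg = id` on subsets of the free edges. -/
lemma freeRed_cfg {P PB : Finset E} {S : Finset E} (hS : S ⊆ freeE P PB) :
    freeRed P PB (cfg P S) = S := by
  ext e
  simp only [freeRed, cfg, toFinset, Finset.mem_sdiff, Finset.mem_filter, Finset.mem_univ, true_and,
    ofFinset_apply, decide_eq_true_eq, Finset.mem_union]
  constructor
  · rintro ⟨h1 | h1, h2⟩
    · exact h1
    · exact absurd (Or.inl h1) h2
  · intro he
    have := hS he
    simp only [freeE, Finset.mem_sdiff, Finset.mem_univ, true_and, Finset.mem_union, not_or] at this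
    exact ⟨Or.inl he, fun h => h.elim this.1 this.2⟩

/-- The free red set lies in the free edges. -/
lemma freeRed_subset {P PB : Finset E} (ζ : Config E) : freeRed P PB ζ ⊆ freeE P PB := by
  intro e he
  simp only [freeRed, Finset.mem_sdiff] at he
  simp [freeE, he.2]

/-- Counting pinned configurations is counting subsets of the free edges. -/
lemma card_filter_pinned {P PB : Finset E} (hd : Disjoint P PB) (Q : Config E → Prop)
    [DecidablePred Q] [DecidablePred fun S : Finset E => Q (cfg P S)] :
    (Finset.univ.filter fun ζ : Config E => Pinned P PB ζ ∧ Q ζ).card =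
      ((freeE P PB).powerset.filter fun S : Finset E => Q (cfg P S)).card := by
  refine Finset.card_nbij' (freeRed P PB) (cfg P) ?_ ?_ ?_ ?_
  · intro ζ hζ
    simp only [Finset.coe_filter, Finset.mem_univ, true_and, Set.mem_setOf_eq,
      Finset.mem_powerset] at hζ ⊢
    refine ⟨freeRed_subset ζ, ?_⟩
    rw [cfg_freeRed hζ.1]; exact hζ.2
  · intro S hS
    simp only [Finset.coe_filter, Finset.mem_univ, true_and, Set.mem_setOf_eq,
      Finset.mem_powerset] at hS ⊢
    exact ⟨pinned_cfg hd hS.1, hS.2⟩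
  · intro ζ hζ
    simp only [Finset.coe_filter, Finset.mem_univ, true_and, Set.mem_setOf_eq] at hζ
    exact cfg_freeRed hζ.1
  · intro S hS
    simp only [Finset.coe_filter, Finset.mem_powerset, Set.mem_setOf_eq] at hS
    exact freeRed_cfg hS.1

/-! ## The events on the cube of the free edges -/

/-- `{C_R(u)(S ∪ P) ∈ 𝓤}`. -/
def evUP (P : Finset E) (u : V) (𝓤 : Set (Set V)) (S : Finset E) : Prop :=
  cluster ends (ofFinset (S ∪ P)) u ∈ 𝓤

omit [Fintype E] in
/-- `{C_R(u)(S ∪ P) ∈ 𝓤}` is increasing for an up-set `𝓤`. -/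
lemma incr_evUP (P : Finset E) (u : V) {𝓤 : Set (Set V)} (h𝓤 : IsUpperSet 𝓤) :
    Incr (evUP ends P u 𝓤) :=
  fun _ _ hST hS => h𝓤 (cluster_mono (ofFinset_mono (Finset.union_subset_union_left hST)) u) hS

/-- `{free red edges inside C_R(h)(S ∪ P) ∈ 𝓕}`. -/
def evRP (P : Finset E) (h : V) (𝓕 : Set (Finset E)) (S : Finset E) : Prop :=
  sComp ends (S ∪ P) h \ P ∈ 𝓕

omit [Fintype E] in
/-- `{free red edges inside C_R(h)(S ∪ P) ∈ 𝓕}` is increasing for an up-set `𝓕`. -/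
lemma incr_evRP (P : Finset E) (h : V) {𝓕 : Set (Finset E)} (h𝓕 : IsUpperSet 𝓕) :
    Incr (evRP ends P h 𝓕) := by
  intro S T hST hS
  refine h𝓕 (Finset.sdiff_subset_sdiff ?_ le_rfl) hS
  exact sComp_mono_of_subset ends h
    ((sComp_subset ends (S ∪ P) h).trans (Finset.union_subset_union_left hST))

/-- `{u ↮ h in S ∪ P}`. -/
def evDP (P : Finset E) (u h : V) (S : Finset E) : Prop := ¬ Carries ends (S ∪ P) u h

omit [Fintype E] in
/-- `{u ↮ h in S ∪ P}` is decreasing. -/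
lemma decr_evDP (P : Finset E) (u h : V) : Decr (evDP ends P u h) :=
  fun _ _ hST hT hS => hT (hS.mono (Finset.union_subset_union_left hST))

omit [Fintype E] in
/-- The `s`-component of `S ∪ P` minus the pins lies in `S`. -/
lemma sComp_sdiff_subset (P : Finset E) (S : Finset E) (s : V) :
    sComp ends (S ∪ P) s \ P ⊆ S := by
  intro e he
  rw [Finset.mem_sdiff] at he
  rcases Finset.mem_union.1 (sComp_subset ends _ s he.1) with h | h
  · exact h
  · exact absurd h he.2

omit [Fintype E] in
/-- If `T` contains the `s`-component of `S ∪ P` minus the pins, `T ∪ P` contains the component. -/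
lemma sComp_subset_union_of {P S T : Finset E} {s : V} (hT : sComp ends (S ∪ P) s \ P ⊆ T) :
    sComp ends (S ∪ P) s ⊆ T ∪ P := by
  intro e he
  by_cases hP : e ∈ P
  · exact Finset.mem_union_right _ hP
  · exact Finset.mem_union_left _ (hT (Finset.mem_sdiff.2 ⟨he, hP⟩))

/-- **Pinned typed rigid one-sided domination, cube form.** -/
theorem count_le_typedRigidP (P PB : Finset E) (u h : V) {𝓤 : Set (Set V)} (h𝓤 : IsUpperSet 𝓤)
    {𝓕 : Set (Finset E)} (h𝓕 : IsUpperSet 𝓕) :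
    ((freeE P PB).powerset.filter fun S : Finset E =>
        evUP ends P u 𝓤 S ∧ evRP ends P h 𝓕 S ∧ evDP ends P u h S).card ≤
      ((freeE P PB).powerset.filter fun S : Finset E =>
        evUP ends P u 𝓤 S ∧ (freeE P PB \ S) ∈ 𝓕 ∧ evDP ends P u h S).card := by
  calc ((freeE P PB).powerset.filter fun S : Finset E =>
        evUP ends P u 𝓤 S ∧ evRP ends P h 𝓕 S ∧ evDP ends P u h S).card
      ≤ ((freeE P PB).powerset.filter fun S : Finset E =>
          DOcc (evUP ends P u 𝓤) (evRP ends P h 𝓕) S ∧ evDP ends P u h S).card := by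
        apply Finset.card_le_card
        intro S hS
        simp only [Finset.mem_filter, Finset.mem_powerset] at hS ⊢
        obtain ⟨hSU, hAS, hJS, hDS⟩ := hS
        refine ⟨hSU, ⟨sComp ends (S ∪ P) u \ P, sComp ends (S ∪ P) h \ P,
          sComp_sdiff_subset ends P S u, sComp_sdiff_subset ends P S h,
          Finset.disjoint_of_subset_left Finset.sdiff_subset
            (Finset.disjoint_of_subset_right Finset.sdiff_subset
              (disjoint_sComp_of_not_carries hDS)), ?_, ?_⟩, hDS⟩
        · intro T hT
          exact h𝓤 (cluster_subset_of_sComp_subset ends u (sComp_subset_union_of ends hT)) hAS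
        · intro T hT
          refine h𝓕 (Finset.sdiff_subset_sdiff ?_ le_rfl) hJS
          exact sComp_mono_of_subset ends h (sComp_subset_union_of ends hT)
    _ ≤ ((freeE P PB).powerset.filter fun S : Finset E =>
          evUP ends P u 𝓤 S ∧ evRP ends P h 𝓕 (freeE P PB \ S) ∧ evDP ends P u h S).card :=
        reimer_decreasing (freeE P PB) (evUP ends P u 𝓤) (evRP ends P h 𝓕) (evDP ends P u h)
          (incr_evUP ends P u h𝓤) (incr_evRP ends P h h𝓕) (decr_evDP ends P u h)
    _ ≤ _ := by
        apply Finset.card_le_card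
        intro S hS
        simp only [Finset.mem_filter, Finset.mem_powerset, evRP] at hS ⊢
        obtain ⟨hSU, hAS, hJS, hDS⟩ := hS
        exact ⟨hSU, hAS, h𝓕 (sComp_sdiff_subset ends P _ h) hJS, hDS⟩

/-- The free red edges inside `C_R(h)` of `cfg P S` are the `h`-component of `S ∪ P` minus `P`
(for `S` free). -/
lemma hRedFree_cfg {P PB : Finset E} (hd : Disjoint P PB) {S : Finset E} (hS : S ⊆ freeE P PB)
    (h : V) : hRedFree ends P PB h (cfg P S) = sComp ends (S ∪ P) h \ P := by
  have h1 : toFinset (cfg P S) = S ∪ P := toFinset_ofFinset _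
  rw [hRedFree, hRed, h1]
  ext e
  simp only [Finset.mem_sdiff, Finset.mem_union, not_or]
  constructor
  · rintro ⟨he, hP, _⟩; exact ⟨he, hP⟩
  · rintro ⟨he, hP⟩
    refine ⟨he, hP, fun hB => ?_⟩
    rcases Finset.mem_union.1 (sComp_subset ends _ h he) with h2 | h2
    · have := hS h2
      simp [freeE, Finset.mem_sdiff, hB] at this
    · exact Finset.disjoint_left.1 hd h2 hB

/-- **Pinned typed rigid one-sided domination**: for every up-set `𝓕` of edge sets,
`#{ζ ∈ tClassP : hRedFree ζ ∈ 𝓕} ≤ #{ζ ∈ tClassP : blue ζ ∈ 𝓕}`. -/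
theorem card_typedRigidP_le {P PB : Finset E} (hd : Disjoint P PB) (u h : V) {𝓤 : Set (Set V)}
    (h𝓤 : IsUpperSet 𝓤) {𝓕 : Set (Finset E)} (h𝓕 : IsUpperSet 𝓕) :
    ((tClassP ends P PB u h 𝓤).filter fun ζ => hRedFree ends P PB h ζ ∈ 𝓕).card ≤
      ((tClassP ends P PB u h 𝓤).filter fun ζ => RigidOS.blueF ζ ∈ 𝓕).card := by
  have e1 : ((tClassP ends P PB u h 𝓤).filter fun ζ => hRedFree ends P PB h ζ ∈ 𝓕) =
      Finset.univ.filter fun ζ => Pinned P PB ζ ∧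
        (cluster ends ζ u ∈ 𝓤 ∧ h ∉ cluster ends ζ u ∧ hRedFree ends P PB h ζ ∈ 𝓕) := by
    rw [tClassP, Finset.filter_filter]; congr 1; ext ζ; tauto
  have e2 : ((tClassP ends P PB u h 𝓤).filter fun ζ => RigidOS.blueF ζ ∈ 𝓕) =
      Finset.univ.filter fun ζ => Pinned P PB ζ ∧
        (cluster ends ζ u ∈ 𝓤 ∧ h ∉ cluster ends ζ u ∧ RigidOS.blueF ζ ∈ 𝓕) := by
    rw [tClassP, Finset.filter_filter]; congr 1; ext ζ; tauto
  rw [e1, e2, card_filter_pinned hd, card_filter_pinned hd]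
  have key := count_le_typedRigidP ends P PB u h h𝓤 h𝓕
  calc ((freeE P PB).powerset.filter fun S : Finset E =>
          cluster ends (cfg P S) u ∈ 𝓤 ∧ h ∉ cluster ends (cfg P S) u ∧
            hRedFree ends P PB h (cfg P S) ∈ 𝓕).card
      = ((freeE P PB).powerset.filter fun S : Finset E =>
          evUP ends P u 𝓤 S ∧ evRP ends P h 𝓕 S ∧ evDP ends P u h S).card := by
        apply congrArg Finset.card
        ext S
        simp only [Finset.mem_filter, Finset.mem_powerset]
        constructor
        · rintro ⟨hS, hU, hh, hF⟩
          refine ⟨hS, hU, ?_, fun hc => hh hc⟩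
          simpa only [evRP, hRedFree_cfg ends hd hS h] using hF
        · rintro ⟨hS, hU, hF, hD⟩
          refine ⟨hS, hU, fun hc => hD hc, ?_⟩
          simpa only [evRP, hRedFree_cfg ends hd hS h] using hF
    _ ≤ ((freeE P PB).powerset.filter fun S : Finset E =>
          evUP ends P u 𝓤 S ∧ (freeE P PB \ S) ∈ 𝓕 ∧ evDP ends P u h S).card := key
    _ ≤ _ := by
        apply Finset.card_le_card
        intro S hS
        simp only [Finset.mem_filter, Finset.mem_powerset] at hS ⊢
        obtain ⟨hS, hU, hF, hD⟩ := hS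
        refine ⟨hS, hU, fun hc => hD hc, h𝓕 ?_ hF⟩
        intro e he
        rw [Finset.mem_sdiff] at he
        rw [RigidOS.mem_blueF]
        simp only [cfg, ofFinset_apply, decide_eq_false_iff_not, Finset.mem_union, not_or]
        have := he.1
        simp only [freeE, Finset.mem_sdiff, Finset.mem_univ, true_and, Finset.mem_union,
          not_or] at this
        exact ⟨he.2, this.1⟩

/-- **The pinned typed rigid one-sided permutation** (Hall): an injection of the pinned class
`{ζ = red on P, blue on PB, C_R(u) ∈ 𝓤, h ∉ C_R(u)}` into itself under which every FREE red edge
inside the red cluster of `h` is blue in the image. -/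
theorem exists_typedRigidOneSidedPinned {P PB : Finset E} (hd : Disjoint P PB) (u h : V)
    {𝓤 : Set (Set V)} (h𝓤 : IsUpperSet 𝓤) :
    ∃ f : {ζ // ζ ∈ tClassP ends P PB u h 𝓤} → Config E, Function.Injective f ∧
      ∀ x, f x ∈ tClassP ends P PB u h 𝓤 ∧
        ∀ e, e ∈ within ends (cluster ends x.1 h) → x.1 e = true → e ∉ P ∪ PB → f x e = false := by
  let D := tClassP ends P PB u h 𝓤
  let R : Config E → Finset E := hRedFree ends P PB h
  let t : {ζ // ζ ∈ D} → Finset (Config E) := fun x => D.filter fun η => ∀ e ∈ R x.1, η e = false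
  have hall : ∀ s : Finset {ζ // ζ ∈ D}, s.card ≤ (s.biUnion t).card := by
    intro s
    obtain ⟨𝓕, h𝓕, h𝓕mem⟩ : ∃ 𝓕 : Set (Finset E), IsUpperSet 𝓕 ∧ ∀ F, F ∈ 𝓕 ↔ ∃ x ∈ s, R x.1 ⊆ F :=
      ⟨{F | ∃ x ∈ s, R x.1 ⊆ F}, fun F F' hFF' ⟨x, hx, hxF⟩ => ⟨x, hx, hxF.trans hFF'⟩,
        fun F => Iff.rfl⟩
    have e1 : s.biUnion t = D.filter fun η => RigidOS.blueF η ∈ 𝓕 := by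
      ext η
      simp only [Finset.mem_biUnion, Finset.mem_filter, t, h𝓕mem]
      constructor
      · rintro ⟨x, hx, hη, hsub⟩
        exact ⟨hη, x, hx, fun e he => RigidOS.mem_blueF.2 (hsub e he)⟩
      · rintro ⟨hη, x, hx, hsub⟩
        exact ⟨x, hx, hη, fun e he => RigidOS.mem_blueF.1 (hsub he)⟩
    have e2 : s.card ≤ (D.filter fun ζ => R ζ ∈ 𝓕).card := by
      refine Finset.card_le_card_of_injOn (fun x => x.1) ?_ ?_
      · intro x hx
        rw [Finset.mem_coe] at hx
        simp only [Finset.mem_coe, Finset.mem_filter, h𝓕mem]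
        exact ⟨x.2, x, hx, le_rfl⟩
      · intro x _ y _ hxy
        exact Subtype.ext hxy
    calc s.card ≤ (D.filter fun ζ => R ζ ∈ 𝓕).card := e2
      _ ≤ (D.filter fun ζ => RigidOS.blueF ζ ∈ 𝓕).card := card_typedRigidP_le ends hd u h h𝓤 h𝓕
      _ = (s.biUnion t).card := by rw [e1]
  obtain ⟨f, hf, hft⟩ := (Finset.all_card_le_biUnion_card_iff_exists_injective t).1 hall
  refine ⟨f, hf, fun x => ?_⟩
  have := hft x
  simp only [t, Finset.mem_filter] at this
  exact ⟨this.1, fun e he hred hfree => this.2 e (mem_hRedFree_of ends he hred hfree)⟩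

end TypedROP

end Summit.Ventures.PercRepro2
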